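import Mathlib
import HarnessLib
import Summits.FinalStateConjecture.FinalStateConjecture.Statement
import Literature.Geometry.Lorentzian.FinalState
import Literature.Geometry.Lorentzian.CauchyDevelopment
import Literature.Geometry.Lorentzian.KerrConvergence
import Literature.Geometry.Lorentzian.KerrSchild
import Literature.Geometry.Lorentzian.CausalityPushUp
import Literature.Geometry.Lorentzian.CausalityOpennessProofs
import Literature.Geometry.Lorentzian.BoostedKerrCausalLegs
import Literature.Uncategorized.HonestCore
import Literature.Uncategorized.LateEscape
import Literature.Uncategorized.OrientationAnchor

/-!
# S4b — no late escape (crux `StarvedNecks.NeckGapDecay`, line `Sketch`, stub `stub_noLateEscape`)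

In a vacuum Cauchy development `𝒟`, for a `C⁴` decomposition `d` of `O = exteriorOf 𝒟 d.charted`
with `HonestCore(d, R₀)` whose input hole charts satisfy `OrientationAnchor`, a hole `i`, radii
`R₀ ≤ R₁`, times `τ₀ ≤ τ₁`, a normalised wall `W` and a chart `Ψg` with G1, G2, G3q, there is no late
escaping sequence (`LateEscape`) from `τ₂ = τ₁`.

Main declarations: `NoLateEscape` (the statement registered as stub S4b, a verbatim copy of the
skeleton's; its hypothesis bundles `HonestCore`, `OrientationAnchor`, `LateEscape`, verbatim the skeleton's,
are the Literature-level `Literature.Uncategorized.HonestCore` / `.OrientationAnchor` / `.LateEscape`, and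
its `exteriorOf` is the summit's `Summit.FinalStateConjecture.exteriorOf`),
`not_lateEscape_core` (the chart-level theorem) and `stub_noLateEscape : NoLateEscape`.

Proof.  (A) `J⁻(q) ∩ J⁺(ιX)` is compact (Hawking–Ellis, Prop. 6.6.6) and `𝒟` is strongly causal, so
the future causal curves inside it have uniformly bounded length `≤ L < ∞`
(`BoostedKerrLegs.exists_arcLength_le_of_mem_causalPast_inter_causalFuture`).  (B) If
`Ψg xₙ → p ∈ O ⊆ I⁻(q)`, then for one large `n` the escape point `xₙ` (rest time `tₙ`, rest radius
`rₙ ≤ W(x⁰ₙ) ≤ tₙ/10 + C`) is joined FROM the collar sphere `{r = R₁ + ½}` by a future timelike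
coordinate segment of `Ψg` at rest speed `½` staying under the wall (leg 2,
`BoostedKerrLegs.leg_two_kinematics`, `BoostedKerrLegs.leg_two_causal`), and the collar point is the top of
the future timelike `Λe₀`-line of the input chart `Ψᵢ = Ψg` down to a fixed rest time (leg 1,
`BoostedKerrLegs.leg_one`), of length `≥ (9/10)(tₙ − 3rₙ − T') → ∞`, inside `O ⊆ J⁺(ιX)` and inside
`J⁻(q)` — contradicting (A).

References: O'Neill 1983, Ch. 5, Lemma 5.26 ff. and Def. 5.11; Ch. 14, pp. 402–403, Cor. 14.1,
Lemma 14.14, Lemma 14.40; Hawking–Ellis 1973, §6.6, Prop. 6.6.6; Beem–Ehrlich 1981, Lemma 3.5; Visser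
arXiv:0706.0622, (32)–(35).
-/

noncomputable section

open scoped Manifold ContDiff Topology ENNReal
open Filter Set MeasureTheory Topology Literature.Geometry.Lorentzian Literature.Uncategorized
open Literature.Geometry.Lorentzian.BoostedKerrLegs

namespace Summit.FinalStateConjecture.FinalStateConjecture.Theorems.NeckGapDecay.ConnectionLevelCones.NoLateEscapeStub
-- the problem namespace `Summit.FinalStateConjecture.FinalStateConjecture` repeats the summit name by design
set_option linter.dupNamespace false
-- instance search through nested operator types `E4 →L[ℝ] E4 →L[ℝ] ℝ`
set_option maxSynthPendingDepth 3

/-! ## The registered statement (verbatim copy of the skeleton's definition) -/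

/-- **S4b — no late escape** (global): in any vacuum Cauchy development, for a `C⁴` decomposition `d` of
`O = exteriorOf 𝒟 d.charted` with `HonestCore(d, R₀)` whose hole charts satisfy `OrientationAnchor`, a hole `i`,
`R₀ ≤ R₁`, `τ₀ ≤ τ₁`, a normalised wall `W` (continuous, non-decreasing, sublinear, slope `≤ 1/(10‖Λᵢ‖²)`), and a
chart `Ψg` with G1, G2 and the quantitative `C⁰` clause G3q from `τ₁`: from some `τ₂ ≥ τ₁` there is no late
escaping sequence (long future timelike coordinate curves in the compact `J⁺(ιX) ∩ J⁻(q)` against the uniform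
length bound under strong causality).  The registered stub statement of the line skeleton
`Cruxes/NeckGapDecay/Lines/Sketch.lean`, verbatim; Summit-level (it mentions `exteriorOf`), hence declared here and
not under `Literature/`; proved below (`stub_noLateEscape`). -/
def NoLateEscape : Prop :=
  ∀ (X : Type) [TopologicalSpace X] [ChartedSpace E3 X] [IsManifold (𝓡 3) ∞ X] [ConnectedSpace X]
    (D : InitialDataSet (𝓡 3) X) (𝒟 : VacuumCauchyDevelopment D)
    (O : Set 𝒟.carrier) (d : FinalStateDecomposition 𝒟.toSpacetime O 4) (R₀ : ℝ),
    O = exteriorOf 𝒟.toCauchyDevelopment d.charted → HonestCore 𝒟.toSpacetime O 4 d R₀ →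
    OrientationAnchor 𝒟.toSpacetime O 4 d R₀ →
    ∀ (i : Fin d.N) (R₁ τ₁ : ℝ) (W : ℝ → ℝ) (Ψg : (d.background i).domain → 𝒟.carrier),
      let B := d.background i; let t := B.time; let r := B.radius;
      let K := ‖(((d.motion i).1 : E4 ≃L[ℝ] E4) : E4 →L[ℝ] E4)‖ ^ 2;
      R₀ ≤ R₁ → d.τ₀ ≤ τ₁ → Continuous W → Monotone W → Tendsto (fun s ↦ W s / s) atTop (𝓝 0) →
      (∀ s s', s ≤ s' → W s' ≤ W s + 1 / (10 * K) * (s' - s)) →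
      (let U : Set B.domain := {x | τ₁ < t x.1 ∧ r x.1 < W (x.1 0) + 1};
        ContMDiffOn 𝓘(ℝ, E4) (𝓡 4) ∞ Ψg U ∧ Topology.IsOpenEmbedding (U.restrict Ψg) ∧ Ψg '' U ⊆ d.charted) →
      (∀ x : B.domain, r x.1 ≤ R₁ + 1 → Ψg x = d.chart i x) →
      (∀ τ, τ₁ ≤ τ → supCkENorm (Subtype.val '' {x : B.domain | t x.1 = τ ∧ r x.1 ≤ W (x.1 0)}) 0
        (𝒟.toSpacetime.deviationExtend B Ψg) ≤ ENNReal.ofReal (1 / (20 * K))) →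
      ∃ τ₂ : ℝ, τ₁ ≤ τ₂ ∧ ¬ LateEscape 𝒟.toSpacetime O B Ψg R₁ τ₂ W

/-! ## The core: a late escaping sequence produces too long a causal curve in `J⁻(q) ∩ J⁺(ιX)` -/

section Core

variable {X : Type} [TopologicalSpace X] [ChartedSpace E3 X] [IsManifold (𝓡 3) ∞ X] [ConnectedSpace X]
  {D : InitialDataSet (𝓡 3) X}

-- Ten-step proof assembled over one large context (≈ 40 `linarith` closings; cumulative typeclass
-- search ≈ 8 s, no single tactic above 0.4 s): measured between 150k and 200k heartbeats, and the
-- default budget of 200k tipped over in two full builds under dependency drift — doubled for headroom.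
set_option maxHeartbeats 400000 in
/-- **No late escape, chart level.** In a Cauchy development `𝒟`, let `B` be the boosted Kerr
background `(Λ, c, M, a)` (`0 < M`, `|a| ≤ M`, `100 M ≤ R₀ ≤ R₁`), `W` a normalised wall (continuous,
non-decreasing, sublinear, slope `≤ 1/(10‖Λ‖²)`), `Ψi` a smooth chart map whose late images lie in
`J⁺(ιX)`, future-oriented along `Λe₀` on the shell `{Ta ≤ t, R₀ ≤ r ≤ R₁ + 1}` and `C⁰`-close to `B`
(`≤ 1/(20‖Λ‖²)`) on `{Tc ≤ t, r ≤ R₁ + 1}`, and `Ψg` a chart map smooth on the tube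
`{τ₁ < t, r < W(x⁰) + 1}`, equal to `Ψi` inside `R₁ + 1` and `C⁰`-close to `B` under the wall from `τ₁`.
Then no sequence `xₙ` with `t(xₙ) → ∞`, `R₁ + 1 ≤ r(xₙ) ≤ W(x⁰ₙ)` has `Ψg xₙ → p` with `p ∈ I⁻(Q)`:
otherwise `Ψg xₙ ≪ q` for a late `n` (`I⁻(q)` open), the escape point is joined from the collar sphere
`{r = R₁ + ½}` by a future causal coordinate segment of `Ψg` (leg 2), and the `Λe₀`-line of `Ψi` below
the collar point from rest time `T'` (leg 1) is a future causal curve in `J⁻(q) ∩ J⁺(ιX)` of length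
`≥ (9/10)(tₙ − 3rₙ − T') > L`, against the uniform bound (A). O'Neill 1983, Ch. 14, Cor. 14.1,
Lemma 14.14; Hawking–Ellis 1973, Prop. 6.6.6. [folklore] -/
theorem not_lateEscape_core (𝒟 : CauchyDevelopment D) (B : ModelBackground) (Λ : lorentzGroup) (c : E4)
    (M a : ℝ) (hB : B = boostedKerrBackground Λ c M a) {R₀ R₁ τ₀ τ₁ Ta Tc : ℝ}
    (hM : 0 < M) (haM : |a| ≤ M) (h100 : 100 * M ≤ R₀) (hR : R₀ ≤ R₁)
    {W : ℝ → ℝ} (hWc : Continuous W) (hWm : Monotone W) (hWs : Tendsto (fun s ↦ W s / s) atTop (𝓝 0))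
    (hWl : ∀ s s', s ≤ s' →
      W s' ≤ W s + 1 / (10 * ‖((Λ : E4 ≃L[ℝ] E4) : E4 →L[ℝ] E4)‖ ^ 2) * (s' - s))
    (Ψi Ψg : B.domain → 𝒟.carrier) (hΨi : ContMDiff 𝓘(ℝ, E4) (𝓡 4) ∞ Ψi)
    (hlate : ∀ y : B.domain, τ₀ < B.time y.1 →
      Ψi y ∈ 𝒟.metric.causalFuture 𝒟.timeOrientation (range 𝒟.embed))
    (hTa : ∀ y : B.domain, Ta ≤ B.time y.1 → R₀ ≤ B.radius y.1 → B.radius y.1 ≤ R₁ + 1 →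
      𝒟.timeOrientation.IsFutureDirected
        (mfderiv 𝓘(ℝ, E4) (𝓡 4) Ψi y ((Λ : E4 ≃L[ℝ] E4) (E4.basisVector 0))))
    (hTc : ∀ y : B.domain, Tc ≤ B.time y.1 → B.radius y.1 ≤ R₁ + 1 →
      ‖𝒟.toSpacetime.deviation B Ψi y‖ ≤ 1 / (20 * ‖((Λ : E4 ≃L[ℝ] E4) : E4 →L[ℝ] E4)‖ ^ 2))
    (hG1 : ContMDiffOn 𝓘(ℝ, E4) (𝓡 4) ∞ Ψg
      {y : B.domain | τ₁ < B.time y.1 ∧ B.radius y.1 < W (y.1 0) + 1})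
    (hG2 : ∀ y : B.domain, B.radius y.1 ≤ R₁ + 1 → Ψg y = Ψi y)
    (hG3 : ∀ y : B.domain, τ₁ ≤ B.time y.1 → B.radius y.1 ≤ W (y.1 0) →
      ‖𝒟.toSpacetime.deviation B Ψg y‖ ≤ 1 / (20 * ‖((Λ : E4 ≃L[ℝ] E4) : E4 →L[ℝ] E4)‖ ^ 2))
    {x : ℕ → B.domain} {p : 𝒟.carrier} {Q : Set 𝒟.carrier}
    (hpQ : p ∈ 𝒟.metric.chronologicalPast 𝒟.timeOrientation Q)
    (htx : Tendsto (fun n ↦ B.time (x n).1) atTop atTop)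
    (hx : ∀ n, R₁ + 1 ≤ B.radius (x n).1 ∧ B.radius (x n).1 ≤ W ((x n).1 0))
    (hlim : Tendsto (fun n ↦ Ψg (x n)) atTop (𝓝 p)) : False := by
  subst hB
  have hone : (1 : ℕ∞ω) ≤ (∞ : ℕ∞ω) := WithTop.coe_le_coe.mpr le_top
  set L₀ := ‖((Λ : E4 ≃L[ℝ] E4) : E4 →L[ℝ] E4)‖ with hL₀
  have hL₀1 : 1 ≤ L₀ := one_le_norm_lorentz Λ
  have hR₁ : 100 * M ≤ R₁ + 1 / 2 := by linarith
  -- Step 1: a point `q ∈ Q` with `p ≪ q`; the uniform length bound at `q`; the wall constant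
  have hpQ' := hpQ
  rw [LorentzianMetric.chronologicalPast, LorentzianMetric.chronologicalFuture_eq_biUnion] at hpQ'
  simp only [mem_iUnion, exists_prop] at hpQ'
  obtain ⟨q, -, hpq⟩ := hpQ'
  have hpq' : p ∈ 𝒟.metric.chronologicalPast 𝒟.timeOrientation {q} := hpq
  obtain ⟨L, hLtop, hL⟩ := exists_arcLength_le_of_mem_causalPast_inter_causalFuture 𝒟 q
  have hL0 : 0 ≤ L.toReal := ENNReal.toReal_nonneg
  obtain ⟨C, hC⟩ := wall_le_tenth hWm hWs (lt_of_lt_of_le one_pos hL₀1) |c 0|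
  -- Step 2: thresholds and a late index
  obtain ⟨T', hT'a, hT'c, hT'1, hT'0⟩ :
      ∃ T' : ℝ, Ta + 1 ≤ T' ∧ Tc + 1 ≤ T' ∧ τ₁ + 1 ≤ T' ∧ τ₀ + 1 ≤ T' := by
    refine ⟨max (max Ta Tc) (max τ₁ τ₀) + 1, ?_, ?_, ?_, ?_⟩ <;>
    linarith [le_max_left (max Ta Tc) (max τ₁ τ₀), le_max_right (max Ta Tc) (max τ₁ τ₀),
      le_max_left Ta Tc, le_max_right Ta Tc, le_max_left τ₁ τ₀, le_max_right τ₁ τ₀]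
  obtain ⟨n, hn0, hn1, hn2⟩ : ∃ n, 0 ≤ (boostedKerrBackground Λ c M a).time (x n).1 ∧
      10 / 7 * (3 * C + T' + 10 / 9 * (L.toReal + 1)) ≤ (boostedKerrBackground Λ c M a).time (x n).1 ∧
      Ψg (x n) ∈ 𝒟.metric.chronologicalPast 𝒟.timeOrientation {q} := by
    have hev0 : ∀ᶠ n in atTop, 0 ≤ (boostedKerrBackground Λ c M a).time (x n).1 :=
      htx.eventually_ge_atTop 0
    have hev1 : ∀ᶠ n in atTop, 10 / 7 * (3 * C + T' + 10 / 9 * (L.toReal + 1)) ≤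
        (boostedKerrBackground Λ c M a).time (x n).1 := htx.eventually_ge_atTop _
    have hev2 : ∀ᶠ n in atTop, Ψg (x n) ∈ 𝒟.metric.chronologicalPast 𝒟.timeOrientation {q} :=
      hlim.eventually_mem
        ((LorentzianMetric.isOpen_chronologicalPast_of_boundaryless _ _ {q}).mem_nhds hpq')
    exact (hev0.and (hev1.and hev2)).exists
  obtain ⟨hRn, hWn⟩ := hx n
  -- Step 3: rest-frame coordinates `(tN, ξ)` of the escape point `xN`
  set xN := x n with hxN
  set z : E4 := poincareInv Λ c xN.1 with hz
  set tN : ℝ := z 0 with htN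
  set ξ : E3 := E4.spatial z with hξ
  have hzts : E4.ofTimeSpace tN ξ = z := E4.ofTimeSpace_time_spatial z
  have hxlab : xN.1 = (Λ : E4 ≃L[ℝ] E4) (E4.ofTimeSpace tN ξ) + c := by
    rw [hzts, hz, apply_poincareInv_add]
  have htN0 : 0 ≤ tN := hn0
  have htN1 : 10 / 7 * (3 * C + T' + 10 / 9 * (L.toReal + 1)) ≤ tN := hn1
  set rN := Kerr.radius a (E4.ofTimeSpace 0 ξ) with hrN
  have hrNeq : (boostedKerrBackground Λ c M a).radius xN.1 = rN := by
    show Kerr.radius a (poincareInv Λ c xN.1) = rN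
    rw [← hz, ← hzts, Kerr.radius_ofTimeSpace]
  have hRn' : R₁ + 1 ≤ rN := by rw [← hrNeq]; exact hRn
  have hWn' : rN ≤ W (((Λ : E4 ≃L[ℝ] E4) (E4.ofTimeSpace tN ξ) + c) 0) := by
    rw [← hxlab, ← hrNeq]; exact hWn
  -- Step 4: the collar scale and the kinematics of leg 2
  obtain ⟨σ, hσ0, hσ1, hcollar⟩ := exists_collar_scale a ξ (R₁ := R₁) (by linarith) hRn'
  set ℓ : ℝ := 2 * ‖ξ‖ * (1 - σ) with hℓ
  set y₁ : E4 := (Λ : E4 ≃L[ℝ] E4) (E4.ofTimeSpace (tN - ℓ) (σ • ξ)) + c with hy₁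
  set u : E4 := (Λ : E4 ≃L[ℝ] E4) (E4.ofTimeSpace 1 ((1 / (2 * ‖ξ‖)) • ξ)) with hu
  obtain ⟨hℓpos, hκξ, hend, hty₁, hry₁, hℓ3, hρ32, hseg⟩ :=
    leg_two_kinematics Λ c hM haM hR₁ hWm hWl hσ0 hσ1 hcollar hWn' hℓ hy₁ hu
  -- Step 5: the wall is below a tenth of the rest time, so the collar time `tN - ℓ` is late
  have hrNW : rN ≤ W (xN.1 0) := by rw [hxlab]; exact hWn'
  have hxN0 : xN.1 0 ≤ L₀ * (tN + 2 * W (xN.1 0)) + |c 0| := by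
    have h1 : xN.1 0 = ((Λ : E4 ≃L[ℝ] E4) (E4.ofTimeSpace tN ξ)) 0 + c 0 := by
      rw [hxlab]; rfl
    have h2 : ((Λ : E4 ≃L[ℝ] E4) (E4.ofTimeSpace tN ξ)) 0 ≤ L₀ * (tN + ‖ξ‖) := by
      have ha := PiLp.norm_apply_le ((Λ : E4 ≃L[ℝ] E4) (E4.ofTimeSpace tN ξ)) 0
      rw [Real.norm_eq_abs] at ha
      have hb : ‖(Λ : E4 ≃L[ℝ] E4) (E4.ofTimeSpace tN ξ)‖ ≤ L₀ * ‖E4.ofTimeSpace tN ξ‖ :=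
        ((Λ : E4 ≃L[ℝ] E4) : E4 →L[ℝ] E4).le_opNorm _
      have hc' : ‖E4.ofTimeSpace tN ξ‖ ≤ tN + ‖ξ‖ := by
        have := norm_ofTimeSpace_le tN ξ
        rwa [abs_of_nonneg htN0] at this
      have hd : L₀ * ‖E4.ofTimeSpace tN ξ‖ ≤ L₀ * (tN + ‖ξ‖) := mul_le_mul_of_nonneg_left hc' (by linarith)
      linarith [le_abs_self (((Λ : E4 ≃L[ℝ] E4) (E4.ofTimeSpace tN ξ)) 0)]
    have h3 : ‖ξ‖ ≤ 2 * W (xN.1 0) := by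
      linarith [Kerr.radius_nonneg a (E4.ofTimeSpace 0 ξ)]
    have h4 : L₀ * (tN + ‖ξ‖) ≤ L₀ * (tN + 2 * W (xN.1 0)) :=
      mul_le_mul_of_nonneg_left (by linarith) (by linarith)
    linarith [le_abs_self (c 0)]
  have hW10 : W (xN.1 0) ≤ tN / 10 + C := hC tN (xN.1 0) htN0 hxN0
  have ht₀ : T' + 10 / 9 * (L.toReal + 1) ≤ tN - ℓ := by linarith
  -- Step 6: the open tube piece `V`, the segment inside it, `C⁰` control and causality along it
  set V : Set E4 := ((boostedKerrBackground Λ c M a).domain : Set E4) ∩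
    {w | τ₁ < (boostedKerrBackground Λ c M a).time w ∧
      (boostedKerrBackground Λ c M a).radius w < W (w 0) + 1} with hV
  have h0c : Continuous fun w : E4 ↦ w 0 := by fun_prop
  have hVo : IsOpen V := by
    have ht : Continuous (boostedKerrBackground Λ c M a).time := h0c.comp (continuous_poincareInv Λ c)
    have hr : Continuous (boostedKerrBackground Λ c M a).radius :=
      (Kerr.continuous_radius a).comp (continuous_poincareInv Λ c)
    have hw : Continuous fun w : E4 ↦ W (w 0) + 1 := (hWc.comp h0c).add continuous_const
    exact (boostedKerrBackground Λ c M a).domain.isOpen.inter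
      ((isOpen_lt continuous_const ht).and (isOpen_lt hr hw))
  have hVB : V ⊆ ((boostedKerrBackground Λ c M a).domain : Set E4) := inter_subset_left
  have hG1' : ContMDiffOn 𝓘(ℝ, E4) (𝓡 4) ∞ Ψg (Subtype.val ⁻¹' V) := hG1.mono fun w hw ↦ hw.2
  have hsegV : ∀ θ ∈ Icc 0 ℓ, y₁ + θ • u ∈ V := by
    intro θ hθ
    obtain ⟨hmem, ht, -, hrhi⟩ := hseg θ hθ
    refine ⟨hmem, ?_, ?_⟩
    · show τ₁ < (boostedKerrBackground Λ c M a).time (y₁ + θ • u)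
      rw [ht]; linarith [hθ.1]
    · show (boostedKerrBackground Λ c M a).radius (y₁ + θ • u) < W ((y₁ + θ • u) 0) + 1
      linarith
  have hdevseg : ∀ θ ∈ Icc 0 ℓ, ∀ h : y₁ + θ • u ∈ ((boostedKerrBackground Λ c M a).domain : Set E4),
      ‖𝒟.toSpacetime.deviation (boostedKerrBackground Λ c M a) Ψg ⟨y₁ + θ • u, h⟩‖ ≤
        1 / (20 * L₀ ^ 2) := by
    intro θ hθ h
    obtain ⟨-, ht, -, hrhi⟩ := hseg θ hθ
    refine hG3 ⟨y₁ + θ • u, h⟩ ?_ hrhi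
    show τ₁ ≤ (boostedKerrBackground Λ c M a).time (y₁ + θ • u)
    rw [ht]; linarith [hθ.1]
  have hcauseg : ∀ θ ∈ Icc 0 ℓ, ∀ h : y₁ + θ • u ∈ ((boostedKerrBackground Λ c M a).domain : Set E4),
      𝒟.metric.IsCausal (mfderiv 𝓘(ℝ, E4) (𝓡 4) Ψg ⟨y₁ + θ • u, h⟩ u) := by
    intro θ hθ h
    obtain ⟨-, -, hrlo, -⟩ := hseg θ hθ
    have hr : 100 * M ≤ (boostedKerrBackground Λ c M a).radius (y₁ + θ • u) := by linarith
    have hv : 𝒟.metric.val (Ψg ⟨y₁ + θ • u, h⟩) (mfderiv 𝓘(ℝ, E4) (𝓡 4) Ψg ⟨y₁ + θ • u, h⟩ u)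
        (mfderiv 𝓘(ℝ, E4) (𝓡 4) Ψg ⟨y₁ + θ • u, h⟩ u) ≤
        -1 + 1 / 2 * (1 / 2) + 1 / 20 + (1 + 1 / 2) * (1 + 1 / 2) / 20 := by
      have := val_mfderiv_lorentz_le 𝒟.toSpacetime Λ c a hM.le Ψg ⟨y₁ + θ • u, h⟩ hr
        (hdevseg θ hθ h) _ _ hκξ.le hκξ.le
      rwa [hκξ] at this
    exact (show 𝒟.metric.IsTimelike _ from lt_of_le_of_lt hv (by norm_num)).isCausal
  -- Step 7: the collar point `y₁c`; `dΨg(u)` is future-directed there (anchor + same timecone)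
  have hy₁mem : y₁ ∈ ((boostedKerrBackground Λ c M a).domain : Set E4) := by
    simpa using (hseg 0 ⟨le_rfl, hℓpos.le⟩).1
  set y₁c : (boostedKerrBackground Λ c M a).domain := ⟨y₁, hy₁mem⟩ with hy₁c
  have hty₁c : (boostedKerrBackground Λ c M a).time y₁c.1 = tN - ℓ := hty₁
  have hry₁c : (boostedKerrBackground Λ c M a).radius y₁c.1 = R₁ + 1 / 2 := hry₁
  have hW₁ : (boostedKerrBackground Λ c M a).radius y₁c.1 ≤ W (y₁c.1 0) := by
    simpa using (hseg 0 ⟨le_rfl, hℓpos.le⟩).2.2.2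
  have hr₁ : 100 * M ≤ (boostedKerrBackground Λ c M a).radius y₁c.1 := by rw [hry₁c]; exact hR₁
  have hdev₁ : ‖𝒟.toSpacetime.deviation (boostedKerrBackground Λ c M a) Ψg y₁c‖ ≤ 1 / (20 * L₀ ^ 2) :=
    hG3 y₁c (by rw [hty₁c]; linarith) hW₁
  have hgerm : Ψg =ᶠ[𝓝 y₁c] Ψi := by
    have ho : IsOpen {w : (boostedKerrBackground Λ c M a).domain |
        (boostedKerrBackground Λ c M a).radius w.1 < R₁ + 1} :=
      isOpen_lt ((Kerr.continuous_radius a).comp ((continuous_poincareInv Λ c).comp continuous_subtype_val))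
        continuous_const
    refine Filter.eventuallyEq_of_mem (ho.mem_nhds ?_) fun w hw ↦ hG2 w (le_of_lt hw)
    show (boostedKerrBackground Λ c M a).radius y₁c.1 < R₁ + 1
    rw [hry₁c]; linarith
  have hΨy₁ : Ψg y₁c = Ψi y₁c := hG2 y₁c (by rw [hry₁c]; linarith)
  have hfd₀ : 𝒟.timeOrientation.IsFutureDirected
      (mfderiv 𝓘(ℝ, E4) (𝓡 4) Ψg y₁c ((Λ : E4 ≃L[ℝ] E4) (E4.basisVector 0))) :=
    isFutureDirected_mfderiv_congr 𝒟.toSpacetime hgerm.symm _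
      (hTa y₁c (by rw [hty₁c]; linarith) (by rw [hry₁c]; linarith) (by rw [hry₁c]; linarith))
  have htl₀ : 𝒟.metric.IsTimelike
      (mfderiv 𝓘(ℝ, E4) (𝓡 4) Ψg y₁c ((Λ : E4 ≃L[ℝ] E4) (E4.basisVector 0))) := by
    have := val_mfderiv_axis_le 𝒟.toSpacetime Λ c a hM.le Ψg y₁c hr₁ hdev₁
    exact lt_of_le_of_lt this (by norm_num)
  have hcross : 𝒟.metric.val (Ψg y₁c)
      (mfderiv 𝓘(ℝ, E4) (𝓡 4) Ψg y₁c ((Λ : E4 ≃L[ℝ] E4) (E4.basisVector 0)))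
      (mfderiv 𝓘(ℝ, E4) (𝓡 4) Ψg y₁c u) < 0 := by
    have h := val_mfderiv_lorentz_le 𝒟.toSpacetime Λ c a hM.le Ψg y₁c hr₁ hdev₁ 0 _ (by simp) hκξ.le
    rw [ofTimeSpace_one_zero, norm_zero, hκξ] at h
    have h' : 𝒟.metric.val (Ψg y₁c)
        (mfderiv 𝓘(ℝ, E4) (𝓡 4) Ψg y₁c ((Λ : E4 ≃L[ℝ] E4) (E4.basisVector 0)))
        (mfderiv 𝓘(ℝ, E4) (𝓡 4) Ψg y₁c u) ≤ -1 + 0 * (1 / 2) + 1 / 20 + (1 + 0) * (1 + 1 / 2) / 20 := h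
    linarith
  have hcau₀ : 𝒟.metric.IsCausal (mfderiv 𝓘(ℝ, E4) (𝓡 4) Ψg y₁c u) := by
    have h := val_mfderiv_lorentz_le 𝒟.toSpacetime Λ c a hM.le Ψg y₁c hr₁ hdev₁ _ _ hκξ.le hκξ.le
    rw [hκξ] at h
    have h' : 𝒟.metric.val (Ψg y₁c) (mfderiv 𝓘(ℝ, E4) (𝓡 4) Ψg y₁c u)
        (mfderiv 𝓘(ℝ, E4) (𝓡 4) Ψg y₁c u) ≤
        -1 + 1 / 2 * (1 / 2) + 1 / 20 + (1 + 1 / 2) * (1 + 1 / 2) / 20 := h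
    exact (show 𝒟.metric.IsTimelike _ from lt_of_le_of_lt h' (by norm_num)).isCausal
  have hfd_u : 𝒟.timeOrientation.IsFutureDirected (mfderiv 𝓘(ℝ, E4) (𝓡 4) Ψg y₁c u) :=
    𝒟.timeOrientation.isFutureDirected_of_val_lt_zero hfd₀ htl₀ hcau₀ hcross
  -- Step 8: leg 2, `Ψi y₁c ≤ Ψg xN ≪ q`
  have hxNmem : y₁ + ℓ • u ∈ ((boostedKerrBackground Λ c M a).domain : Set E4) := by
    rw [hend, ← hxlab]; exact xN.2
  have hJ2 := leg_two_causal 𝒟.toSpacetime (boostedKerrBackground Λ c M a) Ψg hVo hVB hG1' y₁ u hℓpos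
    hsegV hcauseg hy₁mem hxNmem hfd_u
  have hxpt : (⟨y₁ + ℓ • u, hxNmem⟩ : (boostedKerrBackground Λ c M a).domain) = xN :=
    Subtype.ext (by show y₁ + ℓ • u = xN.1; rw [hend, hxlab])
  rw [hxpt] at hJ2
  have hJ2' : Ψg xN ∈ 𝒟.metric.causalFuture 𝒟.timeOrientation {Ψi y₁c} := by
    rw [← hΨy₁]; exact hJ2
  have hqx : q ∈ 𝒟.metric.chronologicalFuture 𝒟.timeOrientation {Ψg xN} :=
    LorentzianMetric.mem_chronologicalFuture_of_mem_chronologicalPast hn2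
  have hqy₁ : q ∈ 𝒟.metric.chronologicalFuture 𝒟.timeOrientation {Ψi y₁c} :=
    LorentzianMetric.mem_chronologicalFuture_of_mem_causalFuture hone hJ2' hqx
  -- Step 9: leg 1, the `Λe₀`-line of `Ψi` below the collar point from rest time `T'`
  have hs₁ : 0 ≤ tN - ℓ - T' := by linarith
  have hfdline : ∀ w : (boostedKerrBackground Λ c M a).domain,
      (boostedKerrBackground Λ c M a).time y₁c.1 - (tN - ℓ - T') ≤ (boostedKerrBackground Λ c M a).time w.1 →
      (boostedKerrBackground Λ c M a).time w.1 ≤ (boostedKerrBackground Λ c M a).time y₁c.1 →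
      (boostedKerrBackground Λ c M a).radius w.1 = (boostedKerrBackground Λ c M a).radius y₁c.1 →
      𝒟.timeOrientation.IsFutureDirected
          (mfderiv 𝓘(ℝ, E4) (𝓡 4) Ψi w ((Λ : E4 ≃L[ℝ] E4) (E4.basisVector 0))) ∧
        𝒟.metric.val (Ψi w) (mfderiv 𝓘(ℝ, E4) (𝓡 4) Ψi w ((Λ : E4 ≃L[ℝ] E4) (E4.basisVector 0)))
          (mfderiv 𝓘(ℝ, E4) (𝓡 4) Ψi w ((Λ : E4 ≃L[ℝ] E4) (E4.basisVector 0))) ≤ -(9 / 10) := by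
    intro w h1 h2 h3
    rw [hty₁c] at h1 h2
    rw [hry₁c] at h3
    have hdev : ‖𝒟.toSpacetime.deviation (boostedKerrBackground Λ c M a) Ψi w‖ ≤ 1 / (20 * L₀ ^ 2) :=
      hTc w (by linarith) (by rw [h3]; linarith)
    exact ⟨hTa w (by linarith) (by rw [h3]; linarith) (by rw [h3]; linarith),
      val_mfderiv_axis_le 𝒟.toSpacetime Λ c a hM.le Ψi w (by rw [h3]; linarith) hdev⟩
  obtain ⟨γ, hγ, -, hpts, hlen, hJ1⟩ := leg_one 𝒟.toSpacetime Λ c M a Ψi hΨi y₁c hfdline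
  -- Step 10: leg 1 lies in `J⁻(q) ∩ J⁺(ιX)` and is too long
  have hmem : ∀ s ∈ Icc 0 (tN - ℓ - T'), γ s ∈ 𝒟.metric.causalPast 𝒟.timeOrientation {q} ∩
      𝒟.metric.causalFuture 𝒟.timeOrientation (range 𝒟.embed) := by
    intro s hs
    refine ⟨?_, ?_⟩
    · have h1 : q ∈ 𝒟.metric.chronologicalFuture 𝒟.timeOrientation {γ s} :=
        LorentzianMetric.mem_chronologicalFuture_of_mem_causalFuture hone (hJ1 s hs) hqy₁
      have h2 : γ s ∈ 𝒟.metric.chronologicalPast 𝒟.timeOrientation {q} :=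
        LorentzianMetric.mem_chronologicalPast_of_mem_chronologicalFuture h1
      exact LorentzianMetric.chronologicalFuture_subset_causalFuture _ _ _ h2
    · obtain ⟨w, hw, htw⟩ := hpts s hs
      rw [hw]
      exact hlate w (by rw [htw, hty₁c]; linarith [hs.1])
  have hbound := hL γ 0 (tN - ℓ - T') hs₁ hγ hmem
  have h1 : ENNReal.ofReal (9 / 10 * (tN - ℓ - T')) ≤ L := hlen.trans hbound
  have h2 : 9 / 10 * (tN - ℓ - T') ≤ L.toReal := by
    have := ENNReal.toReal_mono hLtop.ne h1
    rwa [ENNReal.toReal_ofReal (by linarith)] at this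
  linarith

end Core

/-! ## The registered stub -/

/-- **Registered stub S4b** (`stub_noLateEscape : NoLateEscape`): unpack `LateEscape`, the exterior region
`O = J⁺(ιX) ∩ I⁻(d.charted)` (so `p ∈ I⁻(d.charted)` and late images of the input chart lie in
`O ⊆ J⁺(ιX)`), `HonestCore` (a) (`100 Mᵢ ≤ R₀`), the orientation anchor at radius `R₁ + 1`, the
fixed-radius `C⁴ ⊇ C⁰` convergence of the input chart at radius `R₁ + 1` and the pointwise form of G3q,
and apply `not_lateEscape_core` with `τ₂ = τ₁`. [folklore] -/
theorem stub_noLateEscape : NoLateEscape := by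
  intro X _ _ _ _ D 𝒟 O d R₀ hO hc hanchor i R₁ τ₁ W Ψg B t r K hR hτ hWc hWm hWs hWl hG1 hG2 hG3
  refine ⟨τ₁, le_rfl, ?_⟩
  rintro ⟨x, p, hpO, htx, hxn, hlim⟩
  obtain ⟨hc1, -, -, -⟩ := hc
  obtain ⟨-, h100, -⟩ := hc1 i
  obtain ⟨hG1c, -, -⟩ := hG1
  have hK0 : 0 < K := by
    have h1 : 1 ≤ ‖(((d.motion i).1 : E4 ≃L[ℝ] E4) : E4 →L[ℝ] E4)‖ := one_le_norm_lorentz _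
    show 0 < ‖(((d.motion i).1 : E4 ≃L[ℝ] E4) : E4 →L[ℝ] E4)‖ ^ 2
    positivity
  have hδ : 0 ≤ 1 / (20 * K) := by positivity
  have hδpos : (0 : ℝ≥0∞) < ENNReal.ofReal (1 / (20 * K)) := ENNReal.ofReal_pos.2 (by positivity)
  obtain ⟨Ta, hTa⟩ := hanchor i (R₁ + 1)
  obtain ⟨Tc, hTc⟩ := eventually_atTop.1
    ((d.tendsto_truncDeviationCk i (R₁ + 1)).eventually (gt_mem_nhds hδpos))
  have hpQ : p ∈ 𝒟.metric.chronologicalPast 𝒟.timeOrientation d.charted := by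
    rw [hO] at hpO; exact hpO.2
  have hOS : O ⊆ 𝒟.metric.causalFuture 𝒟.timeOrientation (range 𝒟.embed) := by
    rw [hO]; exact inter_subset_left
  exact not_lateEscape_core 𝒟.toCauchyDevelopment B (d.motion i).1 (d.motion i).2 (d.mass i) (d.spin i)
    rfl (d.mass_pos i) (d.abs_spin_le_mass i) h100 hR hWc hWm hWs hWl (d.chart i) Ψg
    (d.isLateChart i).contMDiff
    (fun y hy ↦ hOS ((d.isLateChart i).image_subset (mem_image_of_mem _ hy)))
    hTa
    (fun y h1 h2 ↦ norm_deviation_le_of_supCkENorm_le _ B (d.chart i) hδ (hTc _ h1).le y ⟨rfl, h2⟩)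
    hG1c hG2
    (fun y h1 h2 ↦ norm_deviation_le_of_supCkENorm_le _ B Ψg hδ (hG3 _ h1) y ⟨rfl, h2⟩)
    hpQ htx (fun n ↦ (hxn n).2) hlim

end Summit.FinalStateConjecture.FinalStateConjecture.Theorems.NeckGapDecay.ConnectionLevelCones.NoLateEscapeStub

end
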